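import Summits.MatrixMultiplication.MatrixMultiplication.Theorems.SoloInformedStepThree
import Summits.MatrixMultiplication.MatrixMultiplication.Theorems.SoloInformedNearRect

/-!
# THEOREM 8.20, Step 3.1: the dirty columns are bounded or half of them carry one `b`-class

This work, §8.8 (T12)(f) Step 3.1 and C3-m2 §5.5–5.6 (B) (gen 107). Setting as in `SoloInformedStepThree`.

`Data.dirty_cols_grouped` composes the Step-3.1 atoms on the DIRTY columns `k ∈ Kd` (column `k` of `b` is `∼ β_k`
on the poor family `Jp` off `Eb k`, `|Eb k| ≤ d`, with a deviation `b(jd k, k) ≁ β_k` inside `Jp`), given `a ∼ α` on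
`I₁ × Jp` off `≤ d` entries per row (`Ea i`) and per column (`Ec j`):
1. the deviation PINS row `k` of `c` to one class `U_k` on `I₁ ∖ Ec (jd k)` [`Data.c_row_pinned`];
2. every pair of dirty columns is bounded (`n²·min(|I₁| − 2d, t) ≤ 2·r·|S⁰|`) or SAME or CROSS
   [`Data.dirty_pair_typed`];
3. at most two SAME-groups [`same_groups`]: a half `Kg ⊆ Kd` on which `β_k ∼ β` is ONE class — so `b(·,k) ∼ β`
   column-wise on `Jp` off `Eb k` for every `k ∈ Kg`, the input of `Data.nearRect_cols` (THEOREM 8.19).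
-/

namespace Summit.MatrixMultiplication.MatrixMultiplication.Theorems.TwistedTPP

namespace FibreLines

variable {ι G : Type*} [AddCommGroup G]
variable {G₀ : Type*} [AddCommGroup G₀] {R : Type*}

/-- **STEP 3.1, dirty columns: bound, or half of them carry one `b`-class.**
[this work, §8.8 (T12)(f) Step 3.1; C3-m2 §5.5] -/
theorem Data.dirty_cols_grouped [Fintype ι] [DecidableEq ι] [Fintype G₀] [DecidableEq G₀] [Fintype R]
    [DecidableEq R] (hG : ∀ x : G, x = -x → x = 0) (D : Data ι G) (Φ : Chart ι G₀) (κ : G → R)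
    (hκ : ∀ x y, κ x = κ y → SignEq x y) (hsep : D.SepAll Φ) {α : G} (I₁ Jp Kd : Finset ι) (d t : ℕ)
    (Ea Ec Eb : ι → Finset ι) (βc : ι → G) (jd : ι → ι)
    (hEa : ∀ i ∈ I₁, (Ea i).card ≤ d ∧ ∀ j ∈ Jp, j ∉ Ea i → SignEq (D.a i j) α)
    (hEc : ∀ j ∈ Jp, (Ec j).card ≤ d ∧ ∀ i ∈ I₁, i ∉ Ec j → SignEq (D.a i j) α)
    (hEb : ∀ k ∈ Kd, (Eb k).card ≤ d ∧ ∀ j ∈ Jp, j ∉ Eb k → SignEq (D.b j k) (βc k))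
    (hjd : ∀ k ∈ Kd, jd k ∈ Jp ∧ ¬ SignEq (βc k) (D.b (jd k) k)) (hJp : 2 * t + 2 * d < Jp.card) :
    Fintype.card ι ^ 2 * min (I₁.card - 2 * d) t ≤ 2 * (Fintype.card R * Fintype.card G₀) ∨
      ∃ Kg ⊆ Kd, Kd.card ≤ 2 * Kg.card ∧
        ∃ β : G, ∀ k ∈ Kg, ∀ j ∈ Jp, j ∉ Eb k → SignEq (D.b j k) β := by
  classical
  by_cases hb : Fintype.card ι ^ 2 * min (I₁.card - 2 * d) t ≤ 2 * (Fintype.card R * Fintype.card G₀)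
  · exact Or.inl hb
  right
  -- (1) pins
  have hpin : ∀ k ∈ Kd, ∃ u : G, ∀ i ∈ I₁ \ Ec (jd k), SignEq (D.c k i) u := by
    intro k hk
    have h2d : 2 * d < Jp.card := by omega
    have hconf : ∀ i ∈ I₁ \ Ec (jd k), i ∈ I₁ ∧ SignEq (D.a i (jd k)) α := fun i hi =>
      ⟨(Finset.mem_sdiff.1 hi).1,
        (hEc _ (hjd k hk).1).2 i (Finset.mem_sdiff.1 hi).1 (Finset.mem_sdiff.1 hi).2⟩
    rcases D.c_row_pinned hG I₁ Jp d (hjd k hk).2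
      (fun i hi => ⟨Ea i, (hEa i hi).1, fun j hj hjE => (hEa i hi).2 j hj hjE⟩)
      ⟨Eb k, (hEb k hk).1, fun j hj hjE => (hEb k hk).2 j hj hjE⟩ h2d with h | h
    · exact ⟨α + βc k, fun i hi => h i (hconf i hi).1 (hconf i hi).2⟩
    · exact ⟨α - βc k, fun i hi => h i (hconf i hi).1 (hconf i hi).2⟩
  set U : ι → G := fun k => if h : k ∈ Kd then (hpin k h).choose else 0 with hU
  have hUspec : ∀ k, ∀ hk : k ∈ Kd, ∀ i ∈ I₁ \ Ec (jd k), SignEq (D.c k i) (U k) := by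
    intro k hk
    simp only [hU, dif_pos hk]
    exact (hpin k hk).choose_spec
  -- (2) pairs
  have hpairs : ∀ k ∈ Kd, ∀ k' ∈ Kd, (SignEq (U k) (U k') ∧ SignEq (βc k) (βc k')) ∨
      (SignEq (U k) (βc k') ∧ SignEq (U k') (βc k)) := by
    intro k hk k' hk'
    have hIs : ∀ i ∈ I₁ \ (Ec (jd k) ∪ Ec (jd k')), i ∈ I₁ \ Ec (jd k) ∧ i ∈ I₁ \ Ec (jd k') := by
      intro i hi
      obtain ⟨hi1, hi2⟩ := Finset.mem_sdiff.1 hi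
      rw [Finset.mem_union, not_or] at hi2
      exact ⟨Finset.mem_sdiff.2 ⟨hi1, hi2.1⟩, Finset.mem_sdiff.2 ⟨hi1, hi2.2⟩⟩
    rcases D.dirty_pair_typed hG Φ κ hκ hsep (I₁ \ (Ec (jd k) ∪ Ec (jd k'))) Jp (Eb k) (Eb k') d t
      (hEb k hk).1 (hEb k' hk').1 (fun j hj hjE => (hEb k hk).2 j hj hjE)
      (fun j hj hjE => (hEb k' hk').2 j hj hjE) (fun i hi => hUspec k hk i (hIs i hi).1)
      (fun i hi => hUspec k' hk' i (hIs i hi).2) hJp with h | h | h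
    · exfalso
      refine hb (le_trans (Nat.mul_le_mul_left _ ?_) h)
      have h1 := Finset.card_le_card_sdiff_add_card (s := I₁) (t := Ec (jd k) ∪ Ec (jd k'))
      have h2 := Finset.card_union_le (Ec (jd k)) (Ec (jd k'))
      have h3 := (hEc _ (hjd k hk).1).1
      have h4 := (hEc _ (hjd k' hk').1).1
      omega
    · exact Or.inl h
    · exact Or.inr h
  -- (3) at most two SAME-groups
  obtain ⟨Kg, hKg, hcard, hsame⟩ := same_groups βc U Kd hpairs
  rcases Kg.eq_empty_or_nonempty with h0 | ⟨k₀, hk₀⟩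
  · exact ⟨Kg, hKg, hcard, 0, by simp [h0]⟩
  · exact ⟨Kg, hKg, hcard, βc k₀, fun k hk j hj hjE =>
      ((hEb k (hKg hk)).2 j hj hjE).trans (hsame k hk k₀ hk₀).1⟩

end FibreLines

end Summit.MatrixMultiplication.MatrixMultiplication.Theorems.TwistedTPP
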